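import Mathlib
import HarnessLib
import Summits.QuantumFields.YangMills.Theorems.MirrorModularBoostsHypercubicLimitCouplingResponseDefsC

/-!
# Stub `stub_volumeFloorOfPolyVolume` for the crux `WeakCouplingHypercubicLimit` (line `Sketch`, reshape r11)

**Polynomial volume growth gives the volume floor of the cold-pressure lever.**  For a scaling
scheme `sch` with `PolyVolume sch` (`a_k⁻¹ ≤ (a_k L_k)^N` eventually), every rate `Δ > 0` and
prefactor `C₀ ≥ 0` admit a constant `K` with `C₀ (2S'+1)³ e^{−Δ a_k S'/2} ≤ K` for all torus
half-sides `S' ≥ L_k`, eventually in `k`.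

Proof.  Put `x_k = a_k L_k` (`→ ∞`, so eventually `x_k ≥ 1`, whence `L_k ≥ 1`) and
`s = a_k S' ≥ x_k ≥ 1` for `S' ≥ L_k`.  Then `a_k⁻¹ ≤ x_k^N ≤ s^N`, `S' = s a_k⁻¹`, so
`(2S'+1)³ ≤ 27 S'³ = 27 s³ a_k⁻³ ≤ 27 s^{3N+3}`, and `s^{3N+3} e^{−Δ s/2} ≤ (3N+3)! (2/Δ)^{3N+3}`
on `s ≥ 0` by `xⁿ/n! ≤ eˣ` at `x = Δ s/2` (Mathlib `Real.pow_div_factorial_le_exp`).  Hence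
`K = C₀ · 27 · (3N+3)! (2/Δ)^{3N+3}` works.

`volumeFloor_real` is the real-variable core and `pow_mul_exp_neg_half_le` the bound
`sⁿ e^{−Δ s/2} ≤ n! (2/Δ)ⁿ`.  (The sibling file `…StubVolumeFloor.lean` proves the same floor with the
hypotheses ordered `0 < Δ → 0 ≤ C₀ → PolyVolume sch`, as registered by the r11 skeleton's stub W4.)
-/

noncomputable section

open Filter Topology
open Literature.MathematicalPhysics.QuantumFieldTheory
open Summit.QuantumFields.YangMills.Cruxes.HypercubicLimit.CouplingResponse

namespace Summit.QuantumFields.YangMills.Theorems.WeakCouplingHypercubicLimit.TraceNormColdPressure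

/-- Polynomial times decaying exponential is bounded on `[0, ∞)`, quantitatively:
`sⁿ e^{−Δ s/2} ≤ n! (2/Δ)ⁿ` for `s ≥ 0`, `Δ > 0` (from `xⁿ/n! ≤ eˣ` at `x = Δ s/2`). [folklore] -/
theorem pow_mul_exp_neg_half_le {Δ : ℝ} (hΔ : 0 < Δ) (n : ℕ) {s : ℝ} (hs : 0 ≤ s) :
    s ^ n * Real.exp (-(Δ * s / 2)) ≤ n.factorial * (2 / Δ) ^ n := by
  have hx : 0 ≤ Δ * s / 2 := by positivity
  have h := Real.pow_div_factorial_le_exp (Δ * s / 2) hx n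
  rw [div_le_iff₀ (by positivity)] at h
  have h2 : s = Δ * s / 2 * (2 / Δ) := by field_simp
  calc s ^ n * Real.exp (-(Δ * s / 2))
      = (Δ * s / 2) ^ n * (2 / Δ) ^ n * Real.exp (-(Δ * s / 2)) := by rw [← mul_pow, ← h2]
    _ ≤ Real.exp (Δ * s / 2) * n.factorial * (2 / Δ) ^ n * Real.exp (-(Δ * s / 2)) :=
        mul_le_mul_of_nonneg_right (mul_le_mul_of_nonneg_right h (by positivity)) (Real.exp_pos _).le
    _ = n.factorial * (2 / Δ) ^ n * (Real.exp (Δ * s / 2) * Real.exp (-(Δ * s / 2))) := by ring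
    _ = n.factorial * (2 / Δ) ^ n := by
        rw [← Real.exp_add, add_neg_cancel, Real.exp_zero, mul_one]

/-- The real-variable core of the volume floor: if `a > 0`, `1 ≤ x`, `a⁻¹ ≤ x ^ N`, `x ≤ a S` and
`1 ≤ S`, then `(2S+1)³ e^{−Δ a S/2} ≤ 27 (3N+3)! (2/Δ)^{3N+3}`. [folklore] -/
theorem volumeFloor_real {Δ a x S : ℝ} {N : ℕ} (hΔ : 0 < Δ) (ha : 0 < a) (hx1 : 1 ≤ x)
    (hinv : a⁻¹ ≤ x ^ N) (hxS : x ≤ a * S) (hS1 : 1 ≤ S) :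
    (2 * S + 1) ^ 3 * Real.exp (-(Δ * a * S / 2)) ≤
      27 * ((3 * N + 3).factorial * (2 / Δ) ^ (3 * N + 3)) := by
  have hs1 : 1 ≤ a * S := hx1.trans hxS
  have hs0 : 0 ≤ a * S := zero_le_one.trans hs1
  have hx0 : 0 ≤ x := zero_le_one.trans hx1
  have hinv' : a⁻¹ ≤ (a * S) ^ N := hinv.trans (pow_le_pow_left₀ hx0 hxS N)
  have hSeq : S = a * S * a⁻¹ := by field_simp
  have hS3 : S ^ 3 ≤ (a * S) ^ (3 * N + 3) := by
    calc S ^ 3 = (a * S) ^ 3 * a⁻¹ ^ 3 := by rw [← mul_pow, ← hSeq]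
      _ ≤ (a * S) ^ 3 * ((a * S) ^ N) ^ 3 :=
          mul_le_mul_of_nonneg_left (pow_le_pow_left₀ (inv_nonneg.2 ha.le) hinv' 3) (pow_nonneg hs0 3)
      _ = (a * S) ^ (3 * N + 3) := by ring
  have h27 : (2 * S + 1) ^ 3 ≤ 27 * (a * S) ^ (3 * N + 3) := by
    calc (2 * S + 1) ^ 3 ≤ (3 * S) ^ 3 := pow_le_pow_left₀ (by linarith) (by linarith) 3
      _ = 27 * S ^ 3 := by ring
      _ ≤ 27 * (a * S) ^ (3 * N + 3) := by linarith [hS3]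
  have hkey := pow_mul_exp_neg_half_le hΔ (3 * N + 3) hs0
  have hexp : Real.exp (-(Δ * a * S / 2)) = Real.exp (-(Δ * (a * S) / 2)) := by rw [mul_assoc]
  rw [hexp]
  calc (2 * S + 1) ^ 3 * Real.exp (-(Δ * (a * S) / 2))
      ≤ 27 * (a * S) ^ (3 * N + 3) * Real.exp (-(Δ * (a * S) / 2)) :=
        mul_le_mul_of_nonneg_right h27 (Real.exp_pos _).le
    _ = 27 * ((a * S) ^ (3 * N + 3) * Real.exp (-(Δ * (a * S) / 2))) := mul_assoc _ _ _
    _ ≤ 27 * ((3 * N + 3).factorial * (2 / Δ) ^ (3 * N + 3)) :=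
        mul_le_mul_of_nonneg_left hkey (by norm_num)

/-- `stub_volumeFloorOfPolyVolume` (V, r11) — **polynomial volume growth gives the volume floor**: if
`a_k⁻¹ ≤ (a_k L_k)^N` eventually then for every `Δ > 0`, `C₀ ≥ 0` there is `K` with
`C₀ (2S'+1)³ e^{−Δ a_k S'/2} ≤ K` for all `S' ≥ L_k`, eventually in `k` (with `s = a_k S' ≥ a_k L_k =: x_k → ∞`:
`(2S'+1)³ ≤ 27 s³ a_k⁻³ ≤ 27 s^{3N+3}` and `sup_s s^{3N+3} e^{−Δs/2} ≤ (3N+3)! (2/Δ)^{3N+3}`). [folklore] -/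
theorem stub_volumeFloorOfPolyVolume :
    ∀ (ι : Type) (sch : SpeciesScheme ι) (Δ C₀ : ℝ), PolyVolume sch → 0 < Δ → 0 ≤ C₀ →
      ∃ K : ℝ, ∀ᶠ k in Filter.atTop, ∀ S' : ℕ, sch.L k ≤ S' →
        C₀ * ((2 * S' + 1 : ℕ) : ℝ) ^ 3 * Real.exp (-(Δ * sch.a k * S' / 2)) ≤ K := by
  intro ι sch Δ C₀ hpv hΔ hC₀
  obtain ⟨N, -, hN⟩ := hpv
  refine ⟨C₀ * (27 * ((3 * N + 3).factorial * (2 / Δ) ^ (3 * N + 3))), ?_⟩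
  filter_upwards [hN, sch.tendsto_L.eventually_ge_atTop 1] with k hk hk1 S' hS'
  have hk1' : 1 ≤ sch.a k * (sch.L k : ℝ) := hk1
  have hL1 : 1 ≤ sch.L k := by
    refine Nat.one_le_iff_ne_zero.2 fun h0 => ?_
    rw [h0, Nat.cast_zero, mul_zero] at hk1'
    exact absurd hk1' (by norm_num)
  have hS1 : (1 : ℝ) ≤ (S' : ℝ) := by exact_mod_cast hL1.trans hS'
  have hLS : (sch.L k : ℝ) ≤ (S' : ℝ) := by exact_mod_cast hS'
  have hxS : sch.a k * (sch.L k : ℝ) ≤ sch.a k * (S' : ℝ) := mul_le_mul_of_nonneg_left hLS (sch.a_pos k).le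
  have h := volumeFloor_real hΔ (sch.a_pos k) hk1' hk hxS hS1
  have hcast : ((2 * S' + 1 : ℕ) : ℝ) = 2 * (S' : ℝ) + 1 := by push_cast; ring
  rw [hcast, mul_assoc]
  exact mul_le_mul_of_nonneg_left h hC₀

end Summit.QuantumFields.YangMills.Theorems.WeakCouplingHypercubicLimit.TraceNormColdPressure

end
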